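import Summits.QuantumFields.YangMills.Theorems.BalabanLadderNTSkewResponseTilt
import Summits.QuantumFields.YangMills.Theorems.LangevinControlUVOSLegsFromFemtoAndGapStubLowerCube
import HarnessLib

/-!
# Crux `NT` (stmt-QuantumFields-19353): skew response, V — clause (i)'s object is the first-order response of a
# ONE-point function: `Q2(f, g) = d/dt|₀ E^{(t·f)}[Σ_y g(s y) dens_y]`

Helper file (`--supports stmt-QuantumFields-19353`) of the fleet lead prover of crux `NT` (unit `ym-spine-19353-p1`,
g5); route-independent (no `Theses` import).  The one-point twin of file II (`…NTSkewResponse.lean`,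
`Q3 = d/dt|₀ Q2`): tilting Wilson's measure on the odd torus `2L+1` by the smeared density `t · F_f`,
`F_f = Σ_x f(s x) dens_x` (a smooth local modulation of the coupling near `supp f`), the smeared ONE-point function
`Σ_y g(s y) E_t[dens_y]` has derivative `Σ_y g(s y) Cov_t(dens_y, F_f)`; at `t = 0` this is exactly the route's smeared
truncated two-point function `Q2_{β,L,s}(f, g)`.  So clause (i) of `LowerBounds` (`Q2(θv, v) ≥ ε`) says: the mean action
density near `supp v` RESPONDS at first order, at rate `≥ ε`, to a local modulation of the coupling near the
REFLECTED region `supp θv` — a one-point statement about a Wilson measure with smoothly site-dependent coupling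
(compare the one-point currency of `Cruxes/NT/Ideas/markov-mirror-dirichlet-response.md`, which is a boundary-law
response; here the source is a coupling modulation and the identity is exact).

* `cov_smearedDens_eq_sum` — `Cov(dens_y, F_f) = Σ_x f(s x) Cov(dens_x, dens_y)` (bounded data, any finite measure);
* `hasDerivAt_tiltedQ1_at` — the derivative at every `t₀` (smeared covariance in the tilted state);
* **`hasDerivAt_tiltedQ1`** — at `t = 0` the derivative is `Q2 G r β L s f g`; `tiltedQ1_zero` — the value at `0` is
  the untilted smeared one-point function `Σ_y g(s y) · torusE(dens_y)`;
* `q2_ge_of_onePointResponse_at` — POINTWISE transfer: a one-point RISE `E^{(t·f)}[G] − E[G] ≥ e·t` on `(0, t₀]`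
  gives `Q2(f, g) ≥ e` (one-sided slope lemma); `q2_le_of_onePointResponse_at` — the mirror statement for a ceiling.

Refs: card `Cruxes/NT/Ideas/skewness-from-asymptotic-freedom.md` §Mechanism 1 (tilt calculus), file I
`…NTSkewResponseTilt.lean` (`hasDerivAt_integral_tilted`).
-/

set_option autoImplicit false

noncomputable section

open scoped SchwartzMap
open MeasureTheory Filter Topology
open Literature.MathematicalPhysics.QuantumFieldTheory Literature.MathematicalPhysics.QuantumLattice
open Literature.Probability.LatticeModels
open Summit.QuantumFields.YangMills.Cruxes.OSLegsFromFemtoAndGap.DlrCollarTransfer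
open Summit.QuantumFields.YangMills.Cruxes.OSLegsFromFemtoAndGap.DlrCollarTransfer.StubLower
  (exists_abs_dens_le)

namespace Summit.QuantumFields.YangMills.Cruxes.NT.SkewResponse

section OnePoint

variable (G : Type) [Group G] [TopologicalSpace G] [IsTopologicalGroup G] [CompactSpace G]
  [MeasurableSpace G] [BorelSpace G] (r : LatticeRep G)

/-- **Covariance with the smeared density is the smeared covariance**: for a finite measure `μ` on torus
configurations, `E[dens_y · F_f] − E[dens_y] E[F_f] = Σ_x f(s x) (E[dens_x dens_y] − E[dens_x] E[dens_y])`,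
`F_f = Σ_x f(s x) dens_x` (everything read on the periodic lift). [folklore] -/
theorem cov_smearedDens_eq_sum (L : ℕ) (s : ℝ) (f : 𝓢(EuclideanSpace ℝ (Fin 4), ℝ))
    (μ : Measure (GaugeConfig 4 (2 * L + 1) G)) [IsFiniteMeasure μ] (y : Fin 4 → ℤ) :
    (∫ U, dens G r y (torusLift (2 * L + 1) U) *
          ∑ x ∈ box 4 L, f (s • siteToE x) * dens G r x (torusLift (2 * L + 1) U) ∂μ) -
        (∫ U, dens G r y (torusLift (2 * L + 1) U) ∂μ) *
          (∫ U, ∑ x ∈ box 4 L, f (s • siteToE x) * dens G r x (torusLift (2 * L + 1) U) ∂μ) =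
      ∑ x ∈ box 4 L, f (s • siteToE x) *
        ((∫ U, dens G r x (torusLift (2 * L + 1) U) * dens G r y (torusLift (2 * L + 1) U) ∂μ) -
          (∫ U, dens G r x (torusLift (2 * L + 1) U) ∂μ) * (∫ U, dens G r y (torusLift (2 * L + 1) U) ∂μ)) := by
  haveI := r.secondCountableTopology
  obtain ⟨C, -, hC⟩ := exists_abs_dens_le G r
  have hmeas : ∀ x : Fin 4 → ℤ, Measurable fun U : GaugeConfig 4 (2 * L + 1) G =>
      dens G r x (torusLift (2 * L + 1) U) :=
    fun x => ((continuous_dens r x).comp (continuous_torusLift _)).measurable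
  have hbd : ∀ (x : Fin 4 → ℤ) (U : GaugeConfig 4 (2 * L + 1) G), |dens G r x (torusLift (2 * L + 1) U)| ≤ C :=
    fun x U => hC x _
  rw [integral_mul_finset_sum (μ := μ) (box 4 L) (fun x => f (s • siteToE x)) (hmeas y) hmeas (hbd y) hbd
      (D := fun x U => dens G r x (torusLift (2 * L + 1) U)),
    integral_finset_sum_mul (μ := μ) (box 4 L) (fun x => f (s • siteToE x)) hmeas hbd
      (D := fun x U => dens G r x (torusLift (2 * L + 1) U))]
  rw [Finset.mul_sum, ← Finset.sum_sub_distrib]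
  refine Finset.sum_congr rfl fun x _ => ?_
  have e : (fun U : GaugeConfig 4 (2 * L + 1) G =>
      dens G r y (torusLift (2 * L + 1) U) * dens G r x (torusLift (2 * L + 1) U)) =
      fun U => dens G r x (torusLift (2 * L + 1) U) * dens G r y (torusLift (2 * L + 1) U) :=
    funext fun U => mul_comm _ _
  rw [e]
  ring

/-- **`d/dt (Σ_y g(s y) Eₜ[dens_y]) = Σ_y g(s y) Covₜ(dens_y, F_f)` at every `t₀`** along the family of Wilson
measures on the torus `2L+1` tilted by `t · F_f`, `F_f = Σ_x f(s x) dens_x`. [folklore] -/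
theorem hasDerivAt_tiltedQ1_at (β : ℝ) (L : ℕ) (s : ℝ) (f g : 𝓢(EuclideanSpace ℝ (Fin 4), ℝ)) (t₀ : ℝ) :
    HasDerivAt
      (fun t => ∑ y ∈ box 4 L, g (s • siteToE y) *
        ∫ U, dens G r y (torusLift (2 * L + 1) U)
          ∂(wilsonMeasure (d := 4) (L := 2 * L + 1) r.ρ β).tilted fun U =>
            t * ∑ x ∈ box 4 L, f (s • siteToE x) * dens G r x (torusLift (2 * L + 1) U))
      (∑ y ∈ box 4 L, g (s • siteToE y) *
        ((∫ U, dens G r y (torusLift (2 * L + 1) U) *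
              ∑ x ∈ box 4 L, f (s • siteToE x) * dens G r x (torusLift (2 * L + 1) U)
            ∂(wilsonMeasure (d := 4) (L := 2 * L + 1) r.ρ β).tilted fun U =>
              t₀ * ∑ x ∈ box 4 L, f (s • siteToE x) * dens G r x (torusLift (2 * L + 1) U)) -
          (∫ U, dens G r y (torusLift (2 * L + 1) U)
            ∂(wilsonMeasure (d := 4) (L := 2 * L + 1) r.ρ β).tilted fun U =>
              t₀ * ∑ x ∈ box 4 L, f (s • siteToE x) * dens G r x (torusLift (2 * L + 1) U)) *
          (∫ U, ∑ x ∈ box 4 L, f (s • siteToE x) * dens G r x (torusLift (2 * L + 1) U)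
            ∂(wilsonMeasure (d := 4) (L := 2 * L + 1) r.ρ β).tilted fun U =>
              t₀ * ∑ x ∈ box 4 L, f (s • siteToE x) * dens G r x (torusLift (2 * L + 1) U))))
      t₀ := by
  haveI := r.secondCountableTopology
  haveI := isProbabilityMeasure_wilsonMeasure (d := 4) (L := 2 * L + 1) r.ρ r.continuous β
  obtain ⟨C, -, hC⟩ := exists_abs_dens_le G r
  have hmeas : ∀ x : Fin 4 → ℤ, Measurable fun U : GaugeConfig 4 (2 * L + 1) G =>
      dens G r x (torusLift (2 * L + 1) U) :=
    fun x => ((continuous_dens r x).comp (continuous_torusLift _)).measurable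
  have hbd : ∀ (x : Fin 4 → ℤ) (U : GaugeConfig 4 (2 * L + 1) G), |dens G r x (torusLift (2 * L + 1) U)| ≤ C :=
    fun x U => hC x _
  have hZm : Measurable fun U : GaugeConfig 4 (2 * L + 1) G =>
      ∑ x ∈ box 4 L, f (s • siteToE x) * dens G r x (torusLift (2 * L + 1) U) :=
    Finset.measurable_sum _ fun x _ => (hmeas x).const_mul _
  have hZb : ∀ U : GaugeConfig 4 (2 * L + 1) G,
      |∑ x ∈ box 4 L, f (s • siteToE x) * dens G r x (torusLift (2 * L + 1) U)| ≤
        ∑ x ∈ box 4 L, |f (s • siteToE x)| * C := by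
    intro U
    refine (Finset.abs_sum_le_sum_abs _ _).trans (Finset.sum_le_sum fun x _ => ?_)
    rw [abs_mul]
    exact mul_le_mul_of_nonneg_left (hbd x U) (abs_nonneg _)
  refine HasDerivAt.fun_sum fun y _ => ?_
  exact (hasDerivAt_integral_tilted (μ := wilsonMeasure (d := 4) (L := 2 * L + 1) r.ρ β) hZm (hmeas y) hZb
    (hbd y) t₀).const_mul _

/-- At `t = 0` the modulated smeared one-point function is the untilted one, `Σ_y g(s y) · torusE(dens_y)`.
[folklore] -/
theorem tiltedQ1_zero (β : ℝ) (L : ℕ) (s : ℝ) (f g : 𝓢(EuclideanSpace ℝ (Fin 4), ℝ)) :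
    (∑ y ∈ box 4 L, g (s • siteToE y) *
        ∫ U, dens G r y (torusLift (2 * L + 1) U)
          ∂(wilsonMeasure (d := 4) (L := 2 * L + 1) r.ρ β).tilted fun U =>
            (0 : ℝ) * ∑ x ∈ box 4 L, f (s • siteToE x) * dens G r x (torusLift (2 * L + 1) U)) =
      ∑ y ∈ box 4 L, g (s • siteToE y) * torusE G r β L (dens G r y) := by
  haveI := isProbabilityMeasure_wilsonMeasure (d := 4) (L := 2 * L + 1) r.ρ r.continuous β
  simp only [tilted_zero_mul, torusE]

/-- **`Q2(f, g) = d/dt|₀ Σ_y g(s y) E^{(t·f)}[dens_y]`** — the route's smeared truncated two-point function is the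
first-order response of the smeared ONE-point function of `g` to tilting Wilson's measure by the smeared density
`t · F_f` (a smooth local modulation of the coupling near `supp f`).  Exact; every `β`, every odd torus, every
spacing. [folklore] -/
theorem hasDerivAt_tiltedQ1 (β : ℝ) (L : ℕ) (s : ℝ) (f g : 𝓢(EuclideanSpace ℝ (Fin 4), ℝ)) :
    HasDerivAt
      (fun t => ∑ y ∈ box 4 L, g (s • siteToE y) *
        ∫ U, dens G r y (torusLift (2 * L + 1) U)
          ∂(wilsonMeasure (d := 4) (L := 2 * L + 1) r.ρ β).tilted fun U =>
            t * ∑ x ∈ box 4 L, f (s • siteToE x) * dens G r x (torusLift (2 * L + 1) U))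
      (Q2 G r β L s f g) 0 := by
  haveI := isProbabilityMeasure_wilsonMeasure (d := 4) (L := 2 * L + 1) r.ρ r.continuous β
  have hd := hasDerivAt_tiltedQ1_at G r β L s f g 0
  refine hd.congr_deriv ?_
  simp only [tilted_zero_mul]
  have e : ∀ y ∈ box 4 L, g (s • siteToE y) *
      ((∫ U, dens G r y (torusLift (2 * L + 1) U) *
            ∑ x ∈ box 4 L, f (s • siteToE x) * dens G r x (torusLift (2 * L + 1) U)
          ∂wilsonMeasure (d := 4) (L := 2 * L + 1) r.ρ β) -
        (∫ U, dens G r y (torusLift (2 * L + 1) U) ∂wilsonMeasure (d := 4) (L := 2 * L + 1) r.ρ β) *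
          (∫ U, ∑ x ∈ box 4 L, f (s • siteToE x) * dens G r x (torusLift (2 * L + 1) U)
            ∂wilsonMeasure (d := 4) (L := 2 * L + 1) r.ρ β)) =
      ∑ x ∈ box 4 L, f (s • siteToE x) * g (s • siteToE y) *
        (torusE G r β L (fun U => dens G r x U * dens G r y U) -
          torusE G r β L (dens G r x) * torusE G r β L (dens G r y)) := by
    intro y _
    rw [cov_smearedDens_eq_sum G r L s f (wilsonMeasure (d := 4) (L := 2 * L + 1) r.ρ β) y, Finset.mul_sum]
    refine Finset.sum_congr rfl fun x _ => ?_
    simp only [torusE]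
    ring
  rw [Finset.sum_congr rfl e, Finset.sum_comm]
  rfl

/-- **Pointwise one-point ⇒ two-point FLOOR.**  At one coupling, one torus, one spacing: if the smeared mean
density of `g` RISES at rate `e` under the modulation `t · F_f`, `t ∈ (0, t₀]`, then `Q2(f, g) ≥ e`. [folklore] -/
theorem q2_ge_of_onePointResponse_at (β : ℝ) (L : ℕ) (s : ℝ) (f g : 𝓢(EuclideanSpace ℝ (Fin 4), ℝ))
    {e t₀ : ℝ} (ht₀ : 0 < t₀)
    (hrise : ∀ t : ℝ, 0 < t → t ≤ t₀ →
      e * t ≤ (∑ y ∈ box 4 L, g (s • siteToE y) *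
          ∫ U, dens G r y (torusLift (2 * L + 1) U)
            ∂(wilsonMeasure (d := 4) (L := 2 * L + 1) r.ρ β).tilted fun U =>
              t * ∑ x ∈ box 4 L, f (s • siteToE x) * dens G r x (torusLift (2 * L + 1) U)) -
        ∑ y ∈ box 4 L, g (s • siteToE y) * torusE G r β L (dens G r y)) :
    e ≤ Q2 G r β L s f g := by
  have hD := hasDerivAt_tiltedQ1 G r β L s f g
  have h0 := tiltedQ1_zero G r β L s f g
  exact le_deriv_of_le_increment (c := e) ht₀ hD (fun t ht htt => by
    have hb := hrise t ht htt
    rw [← h0] at hb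
    simpa only using hb)

/-- **Pointwise one-point ⇒ two-point CEILING** (mirror statement): a rise at rate at most `e` gives `Q2(f, g) ≤ e`.
[folklore] -/
theorem q2_le_of_onePointResponse_at (β : ℝ) (L : ℕ) (s : ℝ) (f g : 𝓢(EuclideanSpace ℝ (Fin 4), ℝ))
    {e t₀ : ℝ} (ht₀ : 0 < t₀)
    (hrise : ∀ t : ℝ, 0 < t → t ≤ t₀ →
      (∑ y ∈ box 4 L, g (s • siteToE y) *
          ∫ U, dens G r y (torusLift (2 * L + 1) U)
            ∂(wilsonMeasure (d := 4) (L := 2 * L + 1) r.ρ β).tilted fun U =>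
              t * ∑ x ∈ box 4 L, f (s • siteToE x) * dens G r x (torusLift (2 * L + 1) U)) -
        ∑ y ∈ box 4 L, g (s • siteToE y) * torusE G r β L (dens G r y) ≤ e * t) :
    Q2 G r β L s f g ≤ e := by
  have hD := hasDerivAt_tiltedQ1 G r β L s f g
  have h0 := tiltedQ1_zero G r β L s f g
  exact deriv_le_of_increment_le (c := e) ht₀ hD (fun t ht htt => by
    have hb := hrise t ht htt
    rw [← h0] at hb
    simpa only using hb)

end OnePoint

end Summit.QuantumFields.YangMills.Cruxes.NT.SkewResponse

end
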